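import Literature.AlgebraicGeometry.HodgeTheory.WeilClassesMoonenZarhinCriterion
import Literature.AlgebraicGeometry.HodgeTheory.AbelianVarietyPullbackAlgebraicClasses
import Literature.AlgebraicGeometry.HodgeTheory.ComplexConjugationHolds
import Literature.AlgebraicGeometry.HodgeTheory.GeneralHodgeCMTypeOfCodimTwo
import Literature.AlgebraicGeometry.Milne1999.HodgeCMImpliesTateFiniteFields
import HarnessLib

/-!
# Milne 2020, Theorem 1 (after Deligne 1982 and André 1992): Hodge classes on a CM abelian variety are sums of pull-backs of Weil classes relative to ONE Galois CM field

Family `hodge`, layer `Literature/AlgebraicGeometry/HodgeTheory`. NAMED FACT (D-0014), the Milne row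
of the reduction layer "Weil classes ⇒ all Hodge classes on abelian varieties of CM type" requested by
the COR-CM cell `pub-hodgecm2` (HODGE LADDER stage 2: `HC_CM :=
Summit.HodgeConjecture.HodgeConjecture.Theses.RankFourFaces.CMAbelianHodge`, assuming PerL; mini binder
table `run/shared/lean/pub/pub-hodgecm2/lit/milne.md`). Companion of
`HodgeTheory/WeilClassesCMReduction.lean`, whose fact
`Andre1992_hodgeClasses_cmAbelianVariety_mem_span_pullback_weilClasses` renders the same theorem in the
Charles–Schnell (Thm. 11.5.21) / Milne endnote M.12 form and explicitly DROPS "one common field for all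
summands". The present file records Milne's sharper printed form: the field is ONE CM field `F`, GALOIS
over `ℚ`, depending only on `A` (any Galois CM field splitting the centre of `End⁰(A)`), and every target
carries an `F`-action of `F`-rank `2p` in degree `2p` — the shape of the COR-CM programme (products of CM
abelian varieties `A_{(F,Θ)}` over one Galois CM field `F`, Weil classes `W_F`).

## Source, verbatim

J. S. Milne, *Hodge classes on abelian varieties*, arXiv:2010.08857 (2020) [`Milne2020HodgeClassesAV`]
(held: `paper:arxiv-2010.08857`, chunks p0001–p0005), "No new results, but the proofs are shorter":

* 1.1: "A complex abelian variety is said to be of CM-type if `End⁰(A)` contains a CM-algebra `E` such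
  that `H¹(A, ℚ)` is free of rank `1` as an `E`-module."
* 2.1: "Let `A` be a complex abelian variety and `ν` a homomorphism from a CM-field `E` into `End⁰(A)`.
  The pair `(A, ν)` is said to be of Weil type if `H^{1,0}(A)` is a free `E ⊗_ℚ ℂ`-module. In this case,
  `d := dim_E H¹(A, ℚ)` is even and the subspace `W_E(A) := ⋀^d_E H¹(A, ℚ)` of `H^d(A, ℚ)` consists of
  Hodge classes (Deligne 1982, 4.4). […] If `λ` can be chosen so that `φ` is split […], then `(A, ν)` is
  said to be of split Weil type."
* **Theorem 1** (chunk p0003) "[André 1992] Let `A` be a complex abelian variety of CM-type. There exist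
  abelian varieties `A_Δ` and homomorphisms `f_Δ : A → A_Δ` such that every Hodge class `t` on `A` can be
  written as a sum `t = ∑ f_Δ^*(t_Δ)` with `t_Δ` a Weil class on `A_Δ`."
* Proof (chunks p0003–p0005): "We may suppose that `A` is a product of simple abelian varieties `A_i` and
  let `E = ∏_i End⁰(A_i)`. […] Let `F` be a CM subfield of `ℂ`, Galois over `ℚ`, splitting the centre of
  `End⁰(A)`. Then `F` splits `E`. We shall show that Theorem 1 holds with each `A_Δ` of split Weil type
  relative to `F`. […] For `s ∈ Δ`, let `A_s = A ⊗_{E,s} F`. Then `A_s` is an abelian variety of CM type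
  `(F, φ_s)` […] the abelian variety `A_Δ := ∏_{s ∈ Δ} A_s` equipped with the diagonal action of `F` is of
  split Weil type. There is a homomorphism `f_Δ : A → A_Δ` […]. In summary: for every subset `Δ` of `S`
  satisfying (2) [`|(t∘Δ) ∩ Φ| = p = |(t∘Δ) ∩ Φ̄|` for all `t ∈ Gal(F/ℚ)`, so `|Δ| = 2p`], we have a
  homomorphism `f_Δ : A → A_Δ` from `A` into an abelian variety `A_Δ` of split Weil type relative to `F`;
  moreover, `f_Δ^*(W_F(A_Δ)) ⊗ ℚ^al` is contained in `B^p(A) ⊗ ℚ^al` and contains `H^{2p}(A)_Δ`. As the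
  subspaces `H^{2p}(A)_Δ` span `B^p ⊗ ℚ^al` (see 1.2(c) [Pohlmann 1968, Thm. 1]), this implies that the
  subspaces `f_Δ^*(W_F(A_Δ))` span `B^p`."

The original: Y. André, *Une remarque à propos des cycles de Hodge de type CM*, Sém. Théorie des
Nombres, Paris 1989–90, Progr. Math. 102 (1992), 1–7 [`Andre1992HodgeCM`]; Deligne's version: LNM 900
(1982) §5 [`Deligne1982HodgeCycles`] (both cited by Milne; André's note is not held — cited through Milne).

## Rendering on the tree's real carriers (weaker than print, hence faithful)

* "`A` of CM-type" (1.1: `H¹(A, ℚ)` free of rank one over a CM-algebra `E ⊂ End⁰(A)`) is the tree's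
  `Milne1999.IsOfCMType A` — `End⁰(A) = A.endAlgebra` contains a commutative reduced `ℚ`-subalgebra of
  dimension `2 dim A` — which is, by `Iff.rfl`, the hypothesis of the stage-2 E-term
  `RankFourFaces.CMAbelianHodge` (item stmt-HodgeConjecture-3052) and of `Milne1999.CMHodgeHypothesisAt`.
* The Galois CM field `F` is given, as everywhere on these carriers (`WeilClassesMoonenZarhinCriterion`,
  `RankFourFaces.RankFourWeilTransport`, `WeilClassesCMReduction`), by a monic `P ∈ ℤ[T]`, irreducible
  over `ℚ`, of degree `e ≥ 2`, with no real root and ONE `Q ∈ ℚ[T]` inducing complex conjugation on all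
  complex roots (CM), and — GALOIS — every complex root a `ℚ`-polynomial in every other
  (`ℚ(ρ) = ℚ(ρ′)` for all roots `ρ, ρ′`, i.e. `ℚ[T]/(P)` is normal). `F` acts on a target `B` through ONE
  endomorphism `ψ : B ⟶ B` with `P(ψ) = 0` in `End B`; "`F`-rank `2p` in degree `2p`" is
  `e · (2p) = 2 dim B` (for `A_Δ = ∏_{s∈Δ} A_s`: `dim A_Δ = |Δ| · e / 2 = p · e`); the Weil classes are the
  tree's `weilClassesField B ψ P (2p) = W_F ⊗ ℂ` (Moonen–Zarhin §1), and the printed `t_Δ ∈ W_F(A_Δ) ⊂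
  H^{2p}(A_Δ, ℚ)` — rational, and of Hodge type `(p,p)` because `A_Δ` is of Weil type (2.1) — becomes
  "`w ∈ weilClassesField B ψ P (2p)`, `IsRationalClass w`, `IsOfHodgeType B.dim B.X (2p) p p w`".
* CONCLUSION recorded: there is ONE such `(P, e)` for `A` such that, for every `p` and every rational class
  `c` of Hodge type `(p,p)` in `H^{2p}(A(ℂ); ℂ)`, `c` lies in the `ℂ`-span of the pull-backs `g^*(w)` of
  such `w` along `ℂ`-morphisms `g : A.X ⟶ B.X`. DROPPED from print (so the statement is WEAKER than the
  theorem): that EVERY Galois CM field splitting `Z(End⁰ A)` serves (only one is asserted), that `A_Δ` is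
  the product `∏_{s∈Δ} A ⊗_{E,s} F` of abelian varieties of CM types `(F, φ_s)` with `∑_{s∈Δ} φ_s ≡ p`,
  "split", that `g = f_Δ` is a homomorphism and `t` a `ℚ`-combination (a rational class in the `ℂ`-span of
  rational classes is in their `ℚ`-span). The case `p = 0` is the trivial summand `Δ = ∅` of print.

Upper bound: NOT a case of the Hodge conjecture — a structural statement about the Hodge ring of a CM
abelian variety; the consumer's shape (algebraicity of the `W_F` ⇒ `HC_CM`) is PROVED below from it.

## References

* [Milne2020HodgeClassesAV] J. S. Milne, Hodge classes on abelian varieties, arXiv:2010.08857, §1 (1.1,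
  1.2), §2 (2.1, 2.2), §3 Thm. 1 and its proof.
* [Andre1992HodgeCM] Y. André, Progr. Math. 102 (1992), 1–7 (the theorem; cited through Milne).
* [Deligne1982HodgeCycles] P. Deligne (notes by J. S. Milne), LNM 900 (1982), §4 Prop. 4.4, §5.
* [Pohlmann1968] H. Pohlmann, Ann. of Math. 88 (1968), Thm. 1 (Milne's 1.2(c)).
* [MoonenZarhin1998WeilClasses] B. Moonen, Yu. Zarhin, Crelle 496 (1998), §1 (`W_F ⊗ ℂ = ⊕_σ ⋀^r V_{ℂ,σ}`).
-/

noncomputable section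

open CategoryTheory

namespace Literature.AlgebraicGeometry.HodgeTheory

open Literature.AlgebraicTopology.SingularHomology

section HodgeTheory

/-- **The data of a Galois CM field `F = ℚ[T]/(P)` of degree `e` on the real carriers**: `P ∈ ℤ[T]`
monic of degree `e ≥ 2`, irreducible over `ℚ`, no complex root real, one `Q ∈ ℚ[T]` acting as complex
conjugation on every complex root (CM: conjugation is the same central automorphism in every
embedding), and every complex root a `ℚ`-polynomial in every other (`F/ℚ` normal). The first five
clauses are symbol-for-symbol those of `WeilClassesCMReduction` /
`RankFourFaces.RankFourWeilTransport`; the last is "Galois" (Milne: "Let `F` be a CM subfield of `ℂ`,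
Galois over `ℚ`"). A predicate (definition, nothing asserted). [cite: Milne2020HodgeClassesAV, §1 1.2 and §3 (proof of Thm. 1)] -/
def IsGaloisCMFieldPoly (P : Polynomial ℤ) (e : ℕ) : Prop :=
  P.Monic ∧ P.natDegree = e ∧ 2 ≤ e ∧ Irreducible (P.map (Int.castRingHom ℚ)) ∧
    (∀ ρ : ℂ, Polynomial.eval₂ (Int.castRingHom ℂ) ρ P = 0 → starRingEnd ℂ ρ ≠ ρ) ∧
    (∃ Q : Polynomial ℚ, ∀ ρ : ℂ, Polynomial.eval₂ (Int.castRingHom ℂ) ρ P = 0 →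
        Polynomial.eval₂ (algebraMap ℚ ℂ) ρ Q = starRingEnd ℂ ρ) ∧
    (∀ ρ ρ' : ℂ, Polynomial.eval₂ (Int.castRingHom ℂ) ρ P = 0 →
        Polynomial.eval₂ (Int.castRingHom ℂ) ρ' P = 0 →
          ∃ R : Polynomial ℚ, Polynomial.eval₂ (algebraMap ℚ ℂ) ρ R = ρ')

/-- Unfolding of `IsGaloisCMFieldPoly`. [cite: Milne2020HodgeClassesAV, §3 (proof of Thm. 1)] -/
theorem isGaloisCMFieldPoly_iff (P : Polynomial ℤ) (e : ℕ) :
    IsGaloisCMFieldPoly P e ↔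
      P.Monic ∧ P.natDegree = e ∧ 2 ≤ e ∧ Irreducible (P.map (Int.castRingHom ℚ)) ∧
        (∀ ρ : ℂ, Polynomial.eval₂ (Int.castRingHom ℂ) ρ P = 0 → starRingEnd ℂ ρ ≠ ρ) ∧
        (∃ Q : Polynomial ℚ, ∀ ρ : ℂ, Polynomial.eval₂ (Int.castRingHom ℂ) ρ P = 0 →
            Polynomial.eval₂ (algebraMap ℚ ℂ) ρ Q = starRingEnd ℂ ρ) ∧
        (∀ ρ ρ' : ℂ, Polynomial.eval₂ (Int.castRingHom ℂ) ρ P = 0 →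
            Polynomial.eval₂ (Int.castRingHom ℂ) ρ' P = 0 →
              ∃ R : Polynomial ℚ, Polynomial.eval₂ (algebraMap ℚ ℂ) ρ R = ρ') :=
  Iff.rfl

/-- A Galois CM field polynomial has degree at least `2` (in particular it is not `2 < e`-restricted:
the imaginary quadratic case `e = 2` — `A` isogenous to a power of a CM elliptic curve — is allowed).
[cite: Milne2020HodgeClassesAV, §1 1.1] -/
theorem IsGaloisCMFieldPoly.two_le {P : Polynomial ℤ} {e : ℕ} (h : IsGaloisCMFieldPoly P e) : 2 ≤ e :=
  h.2.2.1

/-- **The pull-backs of `F`-Weil classes of `F`-rank `2p` to `A`** (the summands `f_Δ^*(t_Δ)` of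
Milne's Theorem 1 on the real carriers): the classes `g^*(w) ∈ H^{2p}(A(ℂ); ℂ)`, `g : A.X ⟶ B.X` a
`ℂ`-morphism to a complex abelian variety `B` carrying `ψ : B ⟶ B` with `P(ψ) = 0` and
`e · (2p) = 2 dim B` (`F = ℚ(ψ)` of `F`-rank `2p` on `H¹(B, ℚ)`), `w` a RATIONAL class of Hodge type
`(p,p)` in `weilClassesField B ψ P (2p) = W_F(B) ⊗ ℂ`. [cite: Milne2020HodgeClassesAV, §2 2.1 and §3 Thm. 1] -/
def weilClassPullbacksField (A : Motives.AbelianVariety ℂ) (P : Polynomial ℤ) (e p : ℕ) :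
    Set (complexBetti A.X (2 * p)) :=
  {c' : complexBetti A.X (2 * p) |
    ∃ (B : Motives.AbelianVariety ℂ) (g : A.X ⟶ B.X) (ψ : B ⟶ B) (w : complexBetti B.X (2 * p)),
      Polynomial.eval₂ (Int.castRingHom (CategoryTheory.End B)) (ψ : CategoryTheory.End B) P = 0 ∧
        e * (2 * p) = 2 * B.dim ∧ w ∈ weilClassesField B ψ P (2 * p) ∧ IsRationalClass w ∧
        IsOfHodgeType B.dim B.X (2 * p) p p w ∧ c' = complexBetti.map g (2 * p) w}

/-- Membership in `weilClassPullbacksField` (definitional). [cite: Milne2020HodgeClassesAV, §3 Thm. 1] -/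
theorem mem_weilClassPullbacksField_iff {A : Motives.AbelianVariety ℂ} {P : Polynomial ℤ} {e p : ℕ}
    {c' : complexBetti A.X (2 * p)} :
    c' ∈ weilClassPullbacksField A P e p ↔
      ∃ (B : Motives.AbelianVariety ℂ) (g : A.X ⟶ B.X) (ψ : B ⟶ B) (w : complexBetti B.X (2 * p)),
        Polynomial.eval₂ (Int.castRingHom (CategoryTheory.End B)) (ψ : CategoryTheory.End B) P = 0 ∧
          e * (2 * p) = 2 * B.dim ∧ w ∈ weilClassesField B ψ P (2 * p) ∧ IsRationalClass w ∧
          IsOfHodgeType B.dim B.X (2 * p) p p w ∧ c' = complexBetti.map g (2 * p) w :=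
  Iff.rfl

/-- **Milne 2020, Theorem 1 (after Deligne 1982 §5 and André 1992): on a complex abelian variety of CM
type every Hodge class is a sum of pull-backs, along homomorphisms `f_Δ : A → A_Δ`, of Weil classes
`W_F(A_Δ)` relative to ONE Galois CM field `F` (any Galois CM subfield of `ℂ` splitting the centre of
`End⁰(A)`), the `A_Δ = ∏_{s∈Δ} A ⊗_{E,s} F` being of split Weil type of `F`-rank `|Δ| = 2p`.** Rendering
(module docstring): for `A : Motives.AbelianVariety ℂ`, smooth projective of dimension `A.dim` (witness
quantified) and of CM type (`Milne1999.IsOfCMType A`, verbatim the hypothesis of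
`RankFourFaces.CMAbelianHodge`), there is a Galois CM field `F = ℚ[T]/(P)` of degree `e`
(`IsGaloisCMFieldPoly P e`) such that for every `p` every rational class of Hodge type `(p,p)` in
`H^{2p}(A(ℂ); ℂ)` lies in the `ℂ`-span of `weilClassPullbacksField A P e p` — the classes `g^*(w)`,
`g : A.X ⟶ B.X`, `P(ψ) = 0` on `B`, `e · (2p) = 2 dim B`, `w` a rational `(p,p)` class of
`weilClassesField B ψ P (2p)`. Weaker than print ("every such `F`", the product/CM-type structure of
`A_Δ`, "split", `g` a homomorphism, `ℚ`-combination are dropped). Users take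
`(h : Milne2020_hodgeClasses_cmType_mem_span_pullback_weilClassesField_galois)`.
[cite: Milne2020HodgeClassesAV, §3 Thm. 1 and its proof ("Let F be a CM subfield of ℂ, Galois over ℚ, splitting the centre of End⁰(A) … each A_Δ of split Weil type relative to F … the subspaces f_Δ^*(W_F(A_Δ)) span B^p")]
[cite: Andre1992HodgeCM, Théorème] [cite: Deligne1982HodgeCycles, §5 and Prop. 4.4] -/
def Milne2020_hodgeClasses_cmType_mem_span_pullback_weilClassesField_galois : Prop :=
  ∀ (A : Motives.AbelianVariety ℂ), Motives.IsSmoothProjective A.dim A.X → Milne1999.IsOfCMType A →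
    ∃ (P : Polynomial ℤ) (e : ℕ), IsGaloisCMFieldPoly P e ∧
      ∀ (p : ℕ) (c : complexBetti A.X (2 * p)), IsRationalClass c →
        IsOfHodgeType A.dim A.X (2 * p) p p c →
          c ∈ Submodule.span ℂ (weilClassPullbacksField A P e p)

/-! ### The consumer's shape: algebraicity of the `F`-Weil classes ⟹ the Hodge conjecture for CM abelian varieties -/

/-- If, for the Galois CM field `F = ℚ[T]/(P)`, the rational `(p,p)` classes of `weilClassesField B ψ P (2p)`
are algebraic on every complex abelian variety `B` with `P(ψ) = 0` of `F`-rank `2p` (the binder `hW`,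
"algebraicity of the `F`-Weil classes"), then every element of `weilClassPullbacksField A P e p` is
algebraic on `A`: pull-backs of algebraic classes along `A.X ⟶ B.X` are algebraic
(`map_mem_algebraicClasses_of_abelianVariety`, proved in the tree). [cite: Milne2020HodgeClassesAV, §3 Thm. 1] -/
theorem weilClassPullbacksField_subset_algebraicClasses {P : Polynomial ℤ} {e : ℕ}
    (hW : ∀ (B : Motives.AbelianVariety ℂ) (ψ : B ⟶ B) (p : ℕ),
      Polynomial.eval₂ (Int.castRingHom (CategoryTheory.End B)) (ψ : CategoryTheory.End B) P = 0 →
      e * (2 * p) = 2 * B.dim →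
        ∀ w ∈ weilClassesField B ψ P (2 * p), IsRationalClass w →
          IsOfHodgeType B.dim B.X (2 * p) p p w → w ∈ algebraicClasses B.X p)
    {A : Motives.AbelianVariety ℂ} (hX : Motives.IsSmoothProjective A.dim A.X) (p : ℕ) :
    weilClassPullbacksField A P e p ⊆ (algebraicClasses A.X p : Set (complexBetti A.X (2 * p))) := by
  rintro _ ⟨B, g, ψ, w, hψ, hdim, hweil, hwQ, hwH, rfl⟩
  exact map_mem_algebraicClasses_of_abelianVariety hX B g (hW B ψ p hψ hdim w hweil hwQ hwH)

/-- **What the fact reduces the Hodge conjecture for CM abelian varieties to** (cycle part; Markman,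
arXiv:2509.23403 §1.1 before Thm. 1.4: "André reduced the Hodge conjecture for abelian varieties of
CM-type to the question of algebraicity of the Weil classes on abelian varieties of split Weil type" —
here, following Milne's proof, Galois CM fields suffice). Granted Milne's Theorem 1, if for
EVERY Galois CM field `F = ℚ(ψ) ≅ ℚ[T]/(P)` (`IsGaloisCMFieldPoly P e`) the rational `(p,p)` classes of
`weilClassesField B ψ P (2p)` are algebraic on every complex abelian variety `B` of `F`-rank `2p` (the
binder `hW`; an OPEN statement beyond the known cases, taken as a hypothesis, not asserted), then every
rational `(p,p)` class on every complex abelian variety of CM type is algebraic: `algebraicClasses A.X p`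
is a `ℂ`-subspace containing the spanning set. [cite: Milne2020HodgeClassesAV, §3 Thm. 1]
[cite: Andre1992HodgeCM, Théorème] [cite: Markman2025SurveySecant, §1.1 (sentence before Thm. 1.4)] -/
theorem mem_algebraicClasses_cmType_of_milne2020
    (h : Milne2020_hodgeClasses_cmType_mem_span_pullback_weilClassesField_galois)
    (hW : ∀ (P : Polynomial ℤ) (e : ℕ), IsGaloisCMFieldPoly P e →
      ∀ (B : Motives.AbelianVariety ℂ) (ψ : B ⟶ B) (p : ℕ),
        Polynomial.eval₂ (Int.castRingHom (CategoryTheory.End B)) (ψ : CategoryTheory.End B) P = 0 →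
        e * (2 * p) = 2 * B.dim →
          ∀ w ∈ weilClassesField B ψ P (2 * p), IsRationalClass w →
            IsOfHodgeType B.dim B.X (2 * p) p p w → w ∈ algebraicClasses B.X p)
    (A : Motives.AbelianVariety ℂ) (hX : Motives.IsSmoothProjective A.dim A.X)
    (hCM : Milne1999.IsOfCMType A) (p : ℕ) (c : complexBetti A.X (2 * p)) (hcQ : IsRationalClass c)
    (hcH : IsOfHodgeType A.dim A.X (2 * p) p p c) : c ∈ algebraicClasses A.X p := by
  obtain ⟨P, e, hP, hspan⟩ := h A hX hCM
  exact (Submodule.span_le.mpr (weilClassPullbacksField_subset_algebraicClasses (hW P e hP) hX p))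
    (hspan p c hcQ hcH)

/-- **Milne's Theorem 1 makes "algebraicity of the Weil classes of every Galois CM field, in every `F`-rank" a sufficient condition for `HC_CM`.**
Granted the fact, algebraicity of the Galois-CM-field Weil classes of every `F`-rank (binder `hW`) gives, for every
complex abelian variety `A`, the tree's per-variety statement `Milne1999.CMHodgeHypothesisAt A`
(smooth projective ∧ CM type ⟹ `HodgeConjectureFor A.dim A.X`), whose universal closure is — by
`Iff.rfl` — the stage-2 E-term `RankFourFaces.CMAbelianHodge = HC_CM`; the Hodge-model conjunct of
`HodgeConjectureFor` is the tree's theorem `nonempty_hodgeModel_holds`.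
[cite: Milne2020HodgeClassesAV, §3 Thm. 1] [cite: Milne1999, §7 p. 72 (hypothesis (H))] -/
theorem cmHodgeHypothesisAt_of_milne2020
    (h : Milne2020_hodgeClasses_cmType_mem_span_pullback_weilClassesField_galois)
    (hW : ∀ (P : Polynomial ℤ) (e : ℕ), IsGaloisCMFieldPoly P e →
      ∀ (B : Motives.AbelianVariety ℂ) (ψ : B ⟶ B) (p : ℕ),
        Polynomial.eval₂ (Int.castRingHom (CategoryTheory.End B)) (ψ : CategoryTheory.End B) P = 0 →
        e * (2 * p) = 2 * B.dim →
          ∀ w ∈ weilClassesField B ψ P (2 * p), IsRationalClass w →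
            IsOfHodgeType B.dim B.X (2 * p) p p w → w ∈ algebraicClasses B.X p)
    (A : Motives.AbelianVariety ℂ) : Milne1999.CMHodgeHypothesisAt A :=
  fun hX hCM ↦ ⟨nonempty_hodgeModel_holds hX,
    fun p c hcQ hcH ↦ mem_algebraicClasses_cmType_of_milne2020 h hW A hX hCM p c hcQ hcH⟩

/-! ### Rank four: Milne 2020 Thm. 1 at `p = 2`, then Hazama 2003 (Milne, AIM talk, Thm. 8.5) -/

/-- **Milne's Theorem 1 at `p = 2`: codimension-two Hodge classes on a CM abelian variety from `F`-rank-FOUR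
Weil classes of Galois CM fields.** Granted the fact, if for every Galois CM field `F = ℚ[T]/(P)`
(`IsGaloisCMFieldPoly P e`) the rational `(2,2)` classes of `weilClassesField B ψ P 4` are algebraic on
every complex abelian variety `B` with `P(ψ) = 0` and `4e = 2 dim B` (binder `h₄`; open in general, taken
as a hypothesis), then every codimension-two Hodge class on every complex abelian variety of CM type is
algebraic (`CMHodgeCodimTwoHypothesisAt`). The `p = 2` instance of `mem_algebraicClasses_cmType_of_milne2020`
with the hypothesis in rank four only. [cite: Milne2020HodgeClassesAV, §3 Thm. 1]
[cite: Milne2007TateFiniteFieldsAIM, §10 (result of André 1992)] -/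
theorem cmHodgeCodimTwoHypothesisAt_of_milne2020_of_rankFourWeilGalois
    (h : Milne2020_hodgeClasses_cmType_mem_span_pullback_weilClassesField_galois)
    (h₄ : ∀ (P : Polynomial ℤ) (e : ℕ), IsGaloisCMFieldPoly P e →
      ∀ (B : Motives.AbelianVariety ℂ) (ψ : B ⟶ B),
        Polynomial.eval₂ (Int.castRingHom (CategoryTheory.End B)) (ψ : CategoryTheory.End B) P = 0 →
        e * (2 * 2) = 2 * B.dim →
          ∀ w ∈ weilClassesField B ψ P (2 * 2), IsRationalClass w →
            IsOfHodgeType B.dim B.X (2 * 2) 2 2 w → w ∈ algebraicClasses B.X 2)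
    (B : Motives.AbelianVariety ℂ) : CMHodgeCodimTwoHypothesisAt B := by
  intro hB hCM c hcQ hcH
  obtain ⟨P, e, hP, hspan⟩ := h B hB hCM
  refine (Submodule.span_le.mpr ?_) (hspan 2 c hcQ hcH)
  rintro _ ⟨B', g, ψ, w, hψ, hdim, hweil, hwQ, hwH, rfl⟩
  exact map_mem_algebraicClasses_of_abelianVariety hB B' g (h₄ P e hP B' ψ hψ hdim w hweil hwQ hwH)

/-- **`HC_CM` from `F`-rank-four Weil classes of Galois CM fields (Milne 2020 Thm. 1 at `p = 2`, then
Hazama 2003 = Milne, AIM talk, Thm. 8.5 "In order to prove the Hodge conjecture for CM abelian varieties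
over `ℂ`, it suffices to prove it in codimension 2").** Granted the two records, algebraicity of the rational
`(2,2)` classes of `weilClassesField B ψ P 4` for every Galois CM field `ℚ(ψ) ≅ ℚ[T]/(P)` acting with
`F`-rank `4` on a complex abelian variety `B` gives Milne's hypothesis (H): `Milne1999.CMHodgeHypothesisAt A`
for every complex abelian variety `A` (its universal closure is `RankFourFaces.CMAbelianHodge = HC_CM`).
The Galois-field neighbour of `cmHodgeHypothesisAt_of_rankFourWeil` (`CMHodgeOfRankFourWeilClasses`, André's
record: all CM fields, split by degree `2` / `> 2`); the COR-CM programme sharpens the hypothesis further to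
the rank-four FACE products `∏_{i=1}^4 A_{(F,Φ_i)}` (`W_RK4`). [cite: Milne2020HodgeClassesAV, §3 Thm. 1]
[cite: Milne2007TateFiniteFieldsAIM, Thm. 8.5] [cite: Hazama2003GHCCM, Thm. 8.3 p. 655] -/
theorem cmHodgeHypothesisAt_of_milne2020_of_rankFourWeilGalois
    (h : Milne2020_hodgeClasses_cmType_mem_span_pullback_weilClassesField_galois)
    (h83 : Hazama2003_generalHodge_cmType_of_hodge_codimTwo)
    (h₄ : ∀ (P : Polynomial ℤ) (e : ℕ), IsGaloisCMFieldPoly P e →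
      ∀ (B : Motives.AbelianVariety ℂ) (ψ : B ⟶ B),
        Polynomial.eval₂ (Int.castRingHom (CategoryTheory.End B)) (ψ : CategoryTheory.End B) P = 0 →
        e * (2 * 2) = 2 * B.dim →
          ∀ w ∈ weilClassesField B ψ P (2 * 2), IsRationalClass w →
            IsOfHodgeType B.dim B.X (2 * 2) 2 2 w → w ∈ algebraicClasses B.X 2)
    (A : Motives.AbelianVariety ℂ) : Milne1999.CMHodgeHypothesisAt A :=
  cmHodgeHypothesisAt_of_codimTwo h83
    (cmHodgeCodimTwoHypothesisAt_of_milne2020_of_rankFourWeilGalois h h₄) A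

end HodgeTheory

end Literature.AlgebraicGeometry.HodgeTheory

end
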